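import Literature.Probability.LatticeModels.SRWHeatKernelDifferences
import HarnessLib

/-!
# Route `UnitScaleTilt`, crux K1 «MinimiserStabilityRegPr» (stmt-QuantumFields-19200), route-R E′ path (α′) — the sup-row residue (hK), input of the biharmonic peeling (A3):
# THE SMALL-DISTANCE LETTER OF THE 1D HEAT KERNEL — the Bessel recurrence `q_t(m−1) − q_t(m+1) = (2m∕t)·q_t(m)` and `|∇q_t(m)| ≲ (|m|+1)·t^{−3∕2}`

Cell `ym3-torus`, D-0154 (3c) twin-width seat `ym-routeR-w2` (gen 5).  THEOREMS ONLY (0 `def`, 0 `sorry`); `--supports stmt-QuantumFields-19200 --as helper`,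
count-neutral.  YM₃ on T³ is a ladder rung (R3), not the Clay problem; nothing here claims the stub, the crux, d = 4 or the gap.

THE POINT (★routeR-w3 g5 19:24:39Z fork call (A3) + «routeR-w2: small-distance letter GO»; ★★OWNER g28 19:27:31Z list).  The `G₂` differences by heat kernel carry the weight
`s` (`ε⁻² = ∫₀^∞ s·e^{−sε}ds`), so the SMALL-DISTANCE regime `|m| ≪ √t` of the 1D kernel matters: there the true gradient is `≍ (|m|∕t)·q_t(m) ≍ |m|·t^{−3∕2}`, one factor
`(|m|+1)∕√t` better than the uniform gradient decay ✓ `SRWHeatKernelDifferences.srwHeatKernel_fwdDiff_decay` (`t⁻¹`).  The mechanism is the EXACT recurrence of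
`q_t(m) = e^{−t}I_m(t)` (`I_{m−1} − I_{m+1} = (2m∕t)I_m`), proved here from the Fourier integral ✓ `SRWHeatKernel1D.srwHeatKernel` by ONE integration by parts:
`cos(k(m−1)) − cos(k(m+1)) = 2 sin(km) sin k`, `sin k·e^{−t(1−cos k)} = −t⁻¹·(d∕dk)e^{−t(1−cos k)}`, boundary `sin(±πm) = 0`.

WHAT IS PROVED (ns `…Theorems.Prop7SRWHeatKernelRecurrence`; letters of lit `Literature.Probability.LatticeModels.SRWHeatKernel1D`).
* `cos_sub_cos_shift` (`cos(k(m−1)) − cos(k(m+1)) = 2 sin(km) sin k`), `integral_sin_mul_sin_mul_exp` (the integration by parts: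
  `∫_{−π}^{π} sin(km) sin k e^{−t(1−cos k)} dk = (m∕t)·2π·q_t(m)`),
  ★★★ `srwHeatKernel_sub_eq` — `q_t(m−1) − q_t(m+1) = (2m∕t)·q_t(m)` (`t ≠ 0`).
* ★★ `abs_symDiff_srwHeatKernel_le` — `|q_t(m+1) − q_t(m−1)| ≤ (2|m|∕t)·|q_t(m)|` (`t > 0`); ★★ `srwHeatKernel_symDiff_decay` — with ✓ `srwHeatKernel_decay`:
  `|q_t(m+1) − q_t(m−1)| ≤ 2A·(|m|∕t)·(1∨t)^{−1∕2}(1 + m²∕(1∨t))^{−p}`.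
* ★★★ `srwHeatKernel_fwdDiff_smallDist` — `∃ A′, ∀ t > 0, ∀ m, |q_t(m+1) − q_t(m)| ≤ A′·(|m| + 1)·t⁻¹·(1∨t)^{−1∕2}·(1 + m²∕(1∨t))^{−p}` (`fwd = ½·sym + ½·snd` with
  ✓ `srwHeatKernel_sndDiff_decay`; for `t ≥ 1` this is the `(|m|+1)·t^{−3∕2}` row).
HONEST SCOPE.  1D letters on `ℤ`; the torus periodisation (✓ `TorusHeatKernel1D.abs_tsum_periodize_le`) and the `d = 3` product∕time-integral bookkeeping are the consumer's.

References: G. F. Lawler, V. Limic, *Random Walk: A Modern Introduction*, CUP 2010 [LawlerLimic2010] (§2.3); T. Bałaban, CMP 96 (1984) 223–250 [Balaban1984PropagatorsII] ((1.9) p.226).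
-/

set_option autoImplicit false

noncomputable section

open scoped BigOperators
open Real intervalIntegral

namespace Summit.QuantumFields.YangMills.Theorems.Prop7SRWHeatKernelRecurrence

open Literature.Probability.LatticeModels

/-- `cos(k(m−1)) − cos(k(m+1)) = 2 sin(km) sin k`. [folklore] -/
theorem cos_sub_cos_shift (k : ℝ) (m : ℤ) :
    Real.cos (k * ((m - 1 : ℤ) : ℝ)) - Real.cos (k * ((m + 1 : ℤ) : ℝ)) = 2 * Real.sin (k * m) * Real.sin k := by
  push_cast
  rw [mul_sub, mul_add, mul_one, Real.cos_sub, Real.cos_add]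
  ring

/-- **INTEGRATION BY PARTS**: `∫_{−π}^{π} sin(km)·sin k·e^{−t(1−cos k)} dk = (m∕t)·(2π·q_t(m))` for `t ≠ 0`. [folklore] -/
theorem integral_sin_mul_sin_mul_exp {t : ℝ} (ht : t ≠ 0) (m : ℤ) :
    ∫ k in (-π)..π, Real.sin (k * m) * Real.sin k * Real.exp (-(t * (1 - Real.cos k)))
      = (m : ℝ) / t * (2 * π * srwHeatKernel t m) := by
  -- `U = sin(km)`, `V = e^{−t(1−cos k)}`, `U' = m cos(km)`, `V' = −t sin k·V`
  have hU : ∀ k : ℝ, HasDerivAt (fun k : ℝ => Real.sin (k * m)) ((m : ℝ) * Real.cos (k * m)) k := by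
    intro k
    have h := ((hasDerivAt_id k).mul_const (m : ℝ)).sin
    simp only [id, one_mul] at h
    convert h using 1; ring
  have hV : ∀ k : ℝ, HasDerivAt (fun k : ℝ => Real.exp (-(t * (1 - Real.cos k))))
      (Real.exp (-(t * (1 - Real.cos k))) * (-(t * Real.sin k))) k := by
    intro k
    have h1 : HasDerivAt (fun k : ℝ => -(t * (1 - Real.cos k))) (-(t * - -Real.sin k)) k :=
      (((Real.hasDerivAt_cos k).const_sub 1).const_mul t).neg
    have h1' : HasDerivAt (fun k : ℝ => -(t * (1 - Real.cos k))) (-(t * Real.sin k)) k := by simpa using h1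
    exact h1'.exp
  have hibp := intervalIntegral.integral_mul_deriv_eq_deriv_mul (a := -π) (b := π)
    (u := fun k : ℝ => Real.sin (k * m)) (v := fun k : ℝ => Real.exp (-(t * (1 - Real.cos k))))
    (u' := fun k : ℝ => (m : ℝ) * Real.cos (k * m)) (v' := fun k : ℝ => Real.exp (-(t * (1 - Real.cos k))) * (-(t * Real.sin k)))
    (fun k _ => hU k) (fun k _ => hV k)
    ((by fun_prop : Continuous fun k : ℝ => (m : ℝ) * Real.cos (k * m)).intervalIntegrable _ _)
    ((by fun_prop : Continuous fun k : ℝ => Real.exp (-(t * (1 - Real.cos k))) * (-(t * Real.sin k))).intervalIntegrable _ _)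
  -- boundary terms vanish: `sin(±πm) = 0`
  have hb1 : Real.sin (π * (m : ℝ)) = 0 := by rw [mul_comm]; exact Real.sin_int_mul_pi m
  have hb2 : Real.sin (-π * (m : ℝ)) = 0 := by
    rw [neg_mul, Real.sin_neg, hb1, neg_zero]
  simp only [hb1, hb2, zero_mul, sub_zero, zero_sub] at hibp
  -- `∫ U·V' = −∫ U'·V`, i.e. `−t·∫ sin(km) sin k V = −m·(2π q)`
  have hq : ∫ k in (-π)..π, (m : ℝ) * Real.cos (k * m) * Real.exp (-(t * (1 - Real.cos k))) = (m : ℝ) * (2 * π * srwHeatKernel t m) := by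
    have e : ∀ k : ℝ, (m : ℝ) * Real.cos (k * m) * Real.exp (-(t * (1 - Real.cos k))) = (m : ℝ) * (Real.cos (k * m) * Real.exp (-(t * (1 - Real.cos k)))) :=
      fun k => by ring
    simp_rw [e]
    rw [intervalIntegral.integral_const_mul]
    congr 1
    unfold srwHeatKernel
    rw [mul_div_cancel₀ _ (by positivity : (2 * π : ℝ) ≠ 0)]
  have hlhs : ∫ k in (-π)..π, Real.sin (k * m) * (Real.exp (-(t * (1 - Real.cos k))) * (-(t * Real.sin k)))
      = -t * ∫ k in (-π)..π, Real.sin (k * m) * Real.sin k * Real.exp (-(t * (1 - Real.cos k))) := by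
    rw [← intervalIntegral.integral_const_mul]
    exact intervalIntegral.integral_congr fun k _ => by ring
  rw [hlhs, hq] at hibp
  -- `−t·I = −m·2πq` ⟹ `I = (m∕t)·2πq`
  field_simp
  linarith

/-- ★★★ **THE BESSEL RECURRENCE OF THE 1D HEAT KERNEL**: `q_t(m−1) − q_t(m+1) = (2m∕t)·q_t(m)` for `t ≠ 0` (`q_t(m) = e^{−t}I_m(t)`, `I_{m−1} − I_{m+1} = (2m∕t)I_m`).
[cite: LawlerLimic2010, §2.3] -/
theorem srwHeatKernel_sub_eq {t : ℝ} (ht : t ≠ 0) (m : ℤ) :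
    srwHeatKernel t (m - 1) - srwHeatKernel t (m + 1) = 2 * (m : ℝ) / t * srwHeatKernel t m := by
  have hπ : (0 : ℝ) < 2 * π := by positivity
  have hc : ∀ n : ℤ, Continuous fun k : ℝ => Real.cos (k * n) * Real.exp (-(t * (1 - Real.cos k))) := fun n => by fun_prop
  unfold srwHeatKernel
  rw [← sub_div, ← intervalIntegral.integral_sub ((hc _).intervalIntegrable _ _) ((hc _).intervalIntegrable _ _)]
  have e : ∀ k : ℝ, Real.cos (k * ((m - 1 : ℤ) : ℝ)) * Real.exp (-(t * (1 - Real.cos k))) - Real.cos (k * ((m + 1 : ℤ) : ℝ)) * Real.exp (-(t * (1 - Real.cos k)))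
      = 2 * (Real.sin (k * m) * Real.sin k * Real.exp (-(t * (1 - Real.cos k)))) := by
    intro k; rw [← sub_mul, cos_sub_cos_shift]; ring
  simp_rw [e]
  rw [intervalIntegral.integral_const_mul, integral_sin_mul_sin_mul_exp ht m]
  unfold srwHeatKernel
  field_simp

/-- ★★ **SMALL-DISTANCE BOUND FOR THE SYMMETRIC DIFFERENCE**: `|q_t(m+1) − q_t(m−1)| ≤ (2|m|∕t)·|q_t(m)|` (`t > 0`). [cite: LawlerLimic2010, §2.3] -/
theorem abs_symDiff_srwHeatKernel_le {t : ℝ} (ht : 0 < t) (m : ℤ) :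
    |srwHeatKernel t (m + 1) - srwHeatKernel t (m - 1)| ≤ 2 * |(m : ℝ)| / t * |srwHeatKernel t m| := by
  rw [abs_sub_comm, srwHeatKernel_sub_eq ht.ne' m, abs_mul, abs_div, abs_mul, abs_of_pos ht, abs_two]

/-- ★★ **Gaussian-weighted form**: with ✓ `srwHeatKernel_decay`, `|q_t(m+1) − q_t(m−1)| ≤ 2A·(|m|∕t)·(1∨t)^{−1∕2}·(1 + m²∕(1∨t))^{−p}`. [cite: LawlerLimic2010, §2.3] -/
theorem srwHeatKernel_symDiff_decay (p : ℕ) : ∃ A : ℝ, 0 < A ∧ ∀ t : ℝ, 0 < t → ∀ m : ℤ,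
    |srwHeatKernel t (m + 1) - srwHeatKernel t (m - 1)|
      ≤ A * (|(m : ℝ)| / t) * (max 1 t) ^ (-(1 / 2 : ℝ)) * ((1 + (m : ℝ) ^ 2 / max 1 t) ^ p)⁻¹ := by
  obtain ⟨A, hA, h⟩ := srwHeatKernel_decay p
  refine ⟨2 * A, by positivity, fun t ht m => ?_⟩
  have h1 := abs_symDiff_srwHeatKernel_le ht m
  have h2 := h t ht m
  have hm : 0 ≤ 2 * |(m : ℝ)| / t := by positivity
  calc |srwHeatKernel t (m + 1) - srwHeatKernel t (m - 1)| ≤ 2 * |(m : ℝ)| / t * |srwHeatKernel t m| := h1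
    _ ≤ 2 * |(m : ℝ)| / t * (A * (max 1 t) ^ (-(1 / 2 : ℝ)) * ((1 + (m : ℝ) ^ 2 / max 1 t) ^ p)⁻¹) := mul_le_mul_of_nonneg_left h2 hm
    _ = 2 * A * (|(m : ℝ)| / t) * (max 1 t) ^ (-(1 / 2 : ℝ)) * ((1 + (m : ℝ) ^ 2 / max 1 t) ^ p)⁻¹ := by ring

/-- ★★★ **THE `(|m|+1)·t^{−3∕2}` GRADIENT ROW** (`fwd = ½·sym + ½·snd`): there is `A′ > 0` with
`|q_t(m+1) − q_t(m)| ≤ A′·(|m| + 1)·t⁻¹·(1∨t)^{−1∕2}·(1 + m²∕(1∨t))^{−p}` for all `t > 0`, `m ∈ ℤ` (note `t⁻¹ ≥ (1∨t)⁻¹`, so for `t ≥ 1` this reads `(|m|+1)t^{−3∕2}×`Gaussian weight).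
[cite: LawlerLimic2010, §2.3] -/
theorem srwHeatKernel_fwdDiff_smallDist (p : ℕ) : ∃ A : ℝ, 0 < A ∧ ∀ t : ℝ, 0 < t → ∀ m : ℤ,
    |srwHeatKernel t (m + 1) - srwHeatKernel t m|
      ≤ A * (|(m : ℝ)| + 1) * t⁻¹ * (max 1 t) ^ (-(1 / 2 : ℝ)) * ((1 + (m : ℝ) ^ 2 / max 1 t) ^ p)⁻¹ := by
  obtain ⟨A₁, hA₁, h₁⟩ := srwHeatKernel_symDiff_decay p
  obtain ⟨A₂, hA₂, h₂⟩ := srwHeatKernel_sndDiff_decay p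
  refine ⟨A₁ + A₂, by positivity, fun t ht m => ?_⟩
  have e : srwHeatKernel t (m + 1) - srwHeatKernel t m
      = (1 / 2) * (srwHeatKernel t (m + 1) - srwHeatKernel t (m - 1)) + (1 / 2) * (srwHeatKernel t (m + 1) - 2 * srwHeatKernel t m + srwHeatKernel t (m - 1)) := by ring
  set W : ℝ := (max 1 t) ^ (-(1 / 2 : ℝ)) * ((1 + (m : ℝ) ^ 2 / max 1 t) ^ p)⁻¹ with hW
  have hW0 : 0 ≤ W := by rw [hW]; positivity
  have hmax : (max 1 t)⁻¹ ≤ t⁻¹ := by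
    rw [inv_le_inv₀ (lt_of_lt_of_le one_pos (le_max_left 1 t)) ht]; exact le_max_right 1 t
  have g1 : |srwHeatKernel t (m + 1) - srwHeatKernel t (m - 1)| ≤ A₁ * (|(m : ℝ)| / t) * W := by
    have := h₁ t ht m; rw [hW]; linarith [this]
  have g2 : |srwHeatKernel t (m + 1) - 2 * srwHeatKernel t m + srwHeatKernel t (m - 1)| ≤ A₂ * t⁻¹ * W := by
    have h := h₂ t ht m
    calc |srwHeatKernel t (m + 1) - 2 * srwHeatKernel t m + srwHeatKernel t (m - 1)|
        ≤ A₂ * ((max 1 t)⁻¹ * (max 1 t) ^ (-(1 / 2 : ℝ))) * ((1 + (m : ℝ) ^ 2 / max 1 t) ^ p)⁻¹ := h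
      _ = A₂ * (max 1 t)⁻¹ * W := by rw [hW]; ring
      _ ≤ A₂ * t⁻¹ * W := by gcongr
  rw [e]
  calc |1 / 2 * (srwHeatKernel t (m + 1) - srwHeatKernel t (m - 1)) + 1 / 2 * (srwHeatKernel t (m + 1) - 2 * srwHeatKernel t m + srwHeatKernel t (m - 1))|
      ≤ |1 / 2 * (srwHeatKernel t (m + 1) - srwHeatKernel t (m - 1))| + |1 / 2 * (srwHeatKernel t (m + 1) - 2 * srwHeatKernel t m + srwHeatKernel t (m - 1))| := abs_add_le _ _
    _ = 1 / 2 * |srwHeatKernel t (m + 1) - srwHeatKernel t (m - 1)| + 1 / 2 * |srwHeatKernel t (m + 1) - 2 * srwHeatKernel t m + srwHeatKernel t (m - 1)| := by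
        rw [abs_mul, abs_mul, abs_of_pos (by norm_num : (0:ℝ) < 1 / 2)]
    _ ≤ 1 / 2 * (A₁ * (|(m : ℝ)| / t) * W) + 1 / 2 * (A₂ * t⁻¹ * W) := by gcongr
    _ ≤ (A₁ + A₂) * (|(m : ℝ)| + 1) * t⁻¹ * W := by
        have hm0 : 0 ≤ |(m : ℝ)| := abs_nonneg _
        have ht0 : 0 ≤ t⁻¹ := by positivity
        have hdiv : |(m : ℝ)| / t = |(m : ℝ)| * t⁻¹ := div_eq_mul_inv _ _
        rw [hdiv]
        have p1 : 0 ≤ A₁ * |(m : ℝ)| * t⁻¹ * W := by positivity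
        have p2 : 0 ≤ A₂ * t⁻¹ * W := by positivity
        have p3 : 0 ≤ A₂ * |(m : ℝ)| * t⁻¹ * W := by positivity
        have p4 : 0 ≤ A₁ * t⁻¹ * W := by positivity
        nlinarith [p1, p2, p3, p4]
    _ = (A₁ + A₂) * (|(m : ℝ)| + 1) * t⁻¹ * (max 1 t) ^ (-(1 / 2 : ℝ)) * ((1 + (m : ℝ) ^ 2 / max 1 t) ^ p)⁻¹ := by rw [hW]; ring

end Summit.QuantumFields.YangMills.Theorems.Prop7SRWHeatKernelRecurrence

end
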